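import Literature.NumberTheory.EllipticCurves.Rank1Residual.Typed.X5DescentShapes
import Literature.NumberTheory.EllipticCurves.KatoDivisibilityAllPrimes
import Summits.BirchSwinnertonDyer.BirchSwinnertonDyer.Theorems.Rank1ResidualX1Defs
import HarnessLib

/-!
# Class O1 = X5 ∖ CM (`p = 2`, every non-CM `E/ℚ` of analytic rank `≤ 1`): TYPED TARGETS of the
# CLASS-CLOSURE lane — the `2`-adic leading-term conjecture shape (E1), the statement-side
# sub-partition with the "extends near-verbatim" prover targets (E2), and the transport comparison
# statements (E3)

HONEST FRAMING (cell `b2b-bsdres`, run/shared/lean/b2b/bsd-rank1-residual/, verbatim in every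
file): the goal of the cell is to DELETE the COMBINATION-SHAPED residual classes of the
Birch–Swinnerton-Dyer formula for ALL analytic-rank `≤ 1` elliptic curves over `ℚ` — "full BSD
formula for every rank `≤ 1` curve in class `C`" assembled STRICTLY from published theorems — so
that the rank-`≤ 1` remainder becomes exactly the CONSTRUCTION-SHAPED classes, which are TYPED
(missing-input `Prop`s), NOT attempted. This is not "finishing BSD". Research routes; no claim
beyond stated classes. Census output = EVIDENCE / conjecture items with held-out validation, never
a Literature fact; nothing here is booked; no mark of RESIDUAL-MAP §I moves.

Unit `b2b-bsdres-cc-typer-4` (lane CLASS-CLOSURE, coordinator ruling 2026-08-21T04:07:19Z; plan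
`HOME/CLASS-CLOSURE-PLAN.md` §3.9 "O1 — X5, p = 2", seat cc-typer-4 → team o1; deliverable note
`HOME/class-closure/O1/TYPING.md`). Class of record: RESIDUAL-MAP §I **O1** = `ClassX5 W 2 ∧ ¬ CM`
(CM at `2`: `r = 0` COVERED by Burungale–Flach 2024 = row C8; `r = 1` is O12 = `CornerFSharp`,
`Partition/CornersCM.lean`), mark OPEN; residue cells of record 5 295 (r0 5 275 / r1 20; semistable
1 128 / not 4 167; every one with `2⁴ ∣ #Ш_an` on every curve of the isogeny class — rmap-3 g5
`x5x12left/x5_left.tsv`, sha16 b1ab8a9b…).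

DEFINITIONS + bookkeeping theorems ONLY. No named fact (`def X : Prop` cited as TRUE) is introduced:
every `def … : Prop` below is either (i) a PREDICATE on `(E, 2)` built from the tree's
`Rank1Residual.Predicates` (sub-partition, E2), (ii) an `@[conjecture]` OBLIGATION of ours (E1 / the
irreducible residue), or (iii) a prover TARGET explicitly labelled "NOT in print; nothing asserted"
(E2 verbatim-extension / E3 comparison statements). The theorems are `Iff.rfl`-level bookkeeping,
the exhaustiveness of the sub-partition, and pointers to kernel theorems already in the tree.

## What is in print at `p = 2` for a NON-CM `E/ℚ` (page-read 2026-08-21; locators in TYPING.md §2)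

* Kato, Astérisque 295 (2004), Thm. 17.4 **(1)(2)** (p. 273): `X(E/ℚ_∞)` is `Λ`-torsion and
  `char_Λ X ∣ 2ⁿ·L₂(E,T)` for SOME `n` at a good ORDINARY `2` — in print WITHOUT parity hypothesis
  (tree: `kato_divisibility_allPrimes W 2`); the INTEGRAL clause (3) (`n = 0` under (12.5.2)) and every
  integral Euler-system statement (12.5 (4), 13.4 (3), 14.5 (3)) print `p ≠ 2`; 17.13: "(17.13.1) is
  exact if `p ≠ 2`, and is exact upto `×2` in the case `p = 2`" (lit-kato KATO2004-TYPING §parity).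
* Greenberg, LNM 1716 (1999), Thm. 4.1 (p. 102 of the held volume): the rank-`0` Euler-characteristic
  formula `f_E(0) ∼ ∏ c_v^{(p)} · #Ẽ(𝔽_p)(p)² · #Sel / #E(ℚ)(p)²` is PRINTED WITHOUT a parity hypothesis
  and the text treats `p = 2` explicitly (held copy chunks p0105–p0106: the archimedean factor
  `𝒫_E^{(∞)}(F_∞)^∨ ∈ {0, Λ/2Λ}` when `E[2] ⊆ E(ℝ)`; p0111: at a NONSPLIT multiplicative `v ∣ 2`,
  "`|ker(r_v)| = 2 c_v^{(p)}`", i.e. the local factor `l_v = 2`); the tree vendors it with `p ≠ 2`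
  (`greenberg_charValue_rankZero`, a deliberate weakening, referee ruling R11.1).
* Mazur–Tate–Teitelbaum 1986 §II.10, Conj. BSD(`p`): stated in the tree at EVERY prime incl. `2`
  (`PAdicBSDConjecture W 2 D`, prelude `e₀ = 2` at `p = 2`).
* Quadratic-twist / congruence TRANSPORT of `BSD(E,2)` in print (all RELATIVE, all landing where
  `Ш(·)[2] = 0` or `#Ш[2^∞] ∣ 4`, hence reaching NONE of the 5 295 residue classes): Cai–Li–Zhai,
  J. LMS 101 (2020) Thm. 1.5; Shu–Zhai, Crelle 775 (2021) Thm. 1.4 (rank 0 AND rank 1 twists);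
  Kriz–Li, FMS 7 (2019) Thm. 5.1 (1)(2); one-sided: S. Zhai, PAMQ (2025) = arXiv:2102.11798 Thm. 1.1.
* Isogeny transport of `BSD(E,2)`: a KERNEL theorem (`Typed.X5.bsdp_two_of_isIsogenous`, Cassels 1965
  via `bsdRHS_eq_of_isIsogenous`).
* NOT in print, not announced, for any non-CM class at `2`: the Eisenstein ("Skinner–Urban") lower
  divisibility of the cyclotomic main conjecture at `2`; Kato's integral divisibility at `2`; a
  `2`-adic Gross–Zagier / Perrin-Riou–Schneider leading-term formula (BMS 2016 Thm. 1.7: "`p > 2`");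
  any signed (`a₂ ∈ {0, ±2}`) or additive (`4 ∣ N`) Selmer/`L`-object at `2`.

## Contents

* §1 `O1.InClass`, the five reduction sub-cells at `2` (`CellGoodOrd`, `CellGoodSS`, `CellMultSplit`,
  `CellMultNonsplit`, `CellAddv`) with `O1.cells_exhaustive`, and the image predicates
  `TwoAdicSurjective` (`ρ_{E,2^∞}` onto `GL₂(ℤ₂)`; decided by `SurjModEight`, Dokchitser–Dokchitser
  2012) / `RationalTwoTorsion` (`= Red W 2`).
* §2 (E1) `O1.TwoAdicBSD W D := PAdicBSDConjecture W 2 D` and `O1.TwoAdicEulerCharRankZero W δ` —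
  Greenberg's formula at `2` with the census CONTROL-TERM slot `2^δ` (`δ = 0` = the printed shape);
  census experiment X8 (cp-bsd-w4) is PRE-REGISTERED, NOT RUN at filing: docstrings say so.
* §3 (E2) prover targets: `O1.KatoDivisibilityAtTwoUpTo W k f` (Kato 17.4 (3) at `2` up to `2^k`;
  `k` unbounded IS in print: `katoDivisibilityAtTwoUpTo_of_allPrimes`), and the irreducible residue
  `O1.MainConjectureLowerDivisibilityAtTwo` (`@[conjecture]`; = the Eisenstein half of the cell's
  `MazurMainConjecture W 2`: `…_of_mazurMainConjecture`).
* §4 (E3) `O1.bsdp_two_iff_of_isIsogenous` (kernel pointer, proved), and the comparison statements a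
  twist / base-change / congruence transport must deliver to reach an O1 pair:
  `O1.TwistTransportAtTwo`, `O1.CongruenceTransportAtTwo` (typed targets; nothing asserted).

References: [Kato2004Asterisque] Thm. 17.4, 17.13; [GreenbergLNM1716] Thm. 4.1, pp. 105–106, 110;
[MazurTateTeitelbaum1986Invent] §II.10; [DokchitserDokchitserMathZ2012] Theorem; [CaiLiZhai2019]
Thm. 1.5; [ShuZhai2021] Thm. 1.4; [KrizLi2019] Thm. 5.1; [Zhai2021BSDExactFormulaTwists] Thm. 1.1;
[Cassels1965ArithmeticVIII]; [Miller2011LMS] Def. 1.1; [SkinnerUrban2014] p. 13 ("p is a fixed odd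
prime"); [BalakrishnanMullerStein2015] Thm. 1.7 ("p > 2").
-/

noncomputable section

open scoped Classical MatrixGroups ModularForm

open CongruenceSubgroup WeierstrassCurve Literature.NumberTheory.EllipticCurves
  Literature.NumberTheory.EllipticCurves.ModularForms Literature.NumberTheory.EllipticCurves.Rank1Residual
  Literature.NumberTheory.EllipticCurves.Rank1Residual.Typed
  Summit.BirchSwinnertonDyer.BirchSwinnertonDyer.Theorems.Rank1ResidualX1Defs

set_option autoImplicit false

namespace Summit.BirchSwinnertonDyer.Rank1Residual.X5.O1

variable (W : WeierstrassCurve ℚ) [W.IsElliptic] [W.IsGloballyMinimal]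

/-! ## §1 The class O1 and its statement-side sub-partition at `2` (E2) -/

/-- **O1** (RESIDUAL-MAP §I): class X5 (`p = 2`, `ClassX5 W p := p = 2`) WITHOUT complex
multiplication — CM pairs at `2` are row C8 (`r = 0`, Burungale–Flach) or the corner O12 (`r = 1`,
`CornerFSharp`). A predicate; nothing asserted. [folklore] -/
def InClass (p : ℕ) : Prop := ClassX5 W p ∧ ¬ W.HasCM

omit [W.IsElliptic] [W.IsGloballyMinimal] in
/-- Unfolding: `O1.InClass W p ↔ p = 2 ∧ ¬ CM`. [folklore] -/
theorem inClass_iff (p : ℕ) : InClass W p ↔ p = 2 ∧ ¬ W.HasCM := Iff.rfl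

/-- Sub-cell **O1-go**: good ORDINARY reduction at `2` (`2 ∤ N`, `a₂` odd, i.e. `a₂ = ±1`; note
`#Ẽ(𝔽₂) = 3 - a₂ ∈ {2, 4}`, so `2` is ALWAYS anomalous here — Greenberg's factor `#Ẽ(𝔽₂)(2)² ∈ {4, 16}`).
The only sub-cell where a cyclotomic main conjecture at `2` is even stated on tree objects
(`MazurMainConjecture W 2`, `kato_divisibility_allPrimes W 2`). `= GoodOrd W 2`. [folklore] -/
def CellGoodOrd : Prop := GoodOrd W 2

/-- Sub-cell **O1-ss**: good SUPERSINGULAR reduction at `2` (`2 ∤ N`, `2 ∣ a₂`, i.e.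
`a₂ ∈ {0, 2, -2}`); no signed (`±` / `♯♭`) Selmer group or `p`-adic `L`-function at `p = 2` is in
print for `a₂ = ±2` (Kobayashi 2003 / Pollack 2003 / Sprung 2012 take `p` odd). `= GoodSS W 2`.
[folklore] -/
def CellGoodSS : Prop := GoodSS W 2

/-- Sub-cell **O1-sm**: SPLIT multiplicative reduction at `2` (exceptional-zero case; the
Greenberg–Stevens formula at `2` has no printed proof — tree flag on `greenberg_stevens`).
[folklore] -/
def CellMultSplit : Prop := W.HasSplitMultiplicativeReductionAtPrime 2

/-- Sub-cell **O1-nm**: NONSPLIT multiplicative reduction at `2` (`a₂ = -1`; Greenberg 1999 p. 110: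
the control factor at `v ∣ 2` is `l_v = |ker r_v| / c_v^{(2)} = 2` when `p = 2`, versus `1` at odd
`p` — a printed `2`-adic control term). [cite: GreenbergLNM1716, §4 p. 110 (held copy chunk p0111)] -/
def CellMultNonsplit : Prop := Mult W 2 ∧ ¬ W.HasSplitMultiplicativeReductionAtPrime 2

/-- Sub-cell **O1-ad**: ADDITIVE reduction at `2` (`4 ∣ N`, `v₂(N) ∈ {2,…,8}`); no Selmer condition /
`2`-adic `L`-function at an additive `2` is formulated in print (Delbourgo 1998 and Kato 14.5 (3)
take `p` odd). `= Addv W 2`. [folklore] -/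
def CellAddv : Prop := Addv W 2

omit [W.IsElliptic] in
/-- **The reduction sub-partition of O1 is exhaustive** (pure logic on the tree's predicates:
`Addv = ¬Good ∧ ¬Mult`, `Good = GoodOrd ∨ GoodSS`, `Mult = split ∨ nonsplit`). [folklore] -/
theorem cells_exhaustive :
    CellGoodOrd W ∨ CellGoodSS W ∨ CellMultSplit W ∨ CellMultNonsplit W ∨ CellAddv W := by
  unfold CellGoodOrd CellGoodSS CellMultSplit CellMultNonsplit CellAddv GoodOrd GoodSS Addv Mult
  by_cases hg : W.HasGoodReductionAtPrime 2
  · by_cases ha : (2 : ℤ) ∣ W.frobeniusTrace 2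
    · exact Or.inr (Or.inl ⟨hg, ha⟩)
    · exact Or.inl ⟨hg, ha⟩
  · by_cases hm : W.HasMultiplicativeReductionAtPrime 2
    · by_cases hs : W.HasSplitMultiplicativeReductionAtPrime 2
      · exact Or.inr (Or.inr (Or.inl hs))
      · exact Or.inr (Or.inr (Or.inr (Or.inl ⟨hm, hs⟩)))
    · exact Or.inr (Or.inr (Or.inr (Or.inr ⟨hg, hm⟩)))

/-- Image axis, large: `ρ_{E,2^∞} : Γ_ℚ → GL₂(ℤ₂)` is SURJECTIVE, spelled as surjectivity onto every
`Aut(E[2ⁿ]) ≅ GL₂(ℤ/2ⁿ)`, `n ≥ 1` (the tree's spelling of "`ρ_{E,p}` surjective" in `kato_divisibility`,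
bsd.S20). This is Kato's integrality hypothesis (12.5.2) at `2` in its strong form. Decision procedure:
`SurjModEight` (Dokchitser–Dokchitser 2012). [cite: DokchitserDokchitserMathZ2012, Theorem and Introduction] -/
def TwoAdicSurjective : Prop := ∀ n : ℕ, 0 < n → W.HasSurjectiveModNGaloisRep ((2 : ℤ) ^ n)

/-- Image axis, the finite test: `ρ̄_{E,8}` surjective. Dokchitser–Dokchitser, Math. Z. 272 (2012),
Introduction: "`ρ̄_{ℓⁿ}` surjective ⟹ `ρ̄_{ℓⁿ⁺¹}` surjective" fails only for `ℓⁿ ∈ {2, 3, 4}`, so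
`SurjModEight W → TwoAdicSurjective W`; their Theorem decides it: `ρ̄₂` onto ⟺ the `2`-division cubic is
irreducible and `Δ ∉ ℚ^{×2}`; `ρ̄₄` onto ⟺ `ρ̄₂` onto, `Δ ∉ -ℚ^{×2}`, `j ≠ -4t³(t+8)`; `ρ̄₈` onto ⟺
`ρ̄₄` onto and `Δ ∉ ±2·ℚ^{×2}`. (The implication is NOT vendored as a fact here; the census computes
the bit.) [cite: DokchitserDokchitserMathZ2012, Theorem] -/
def SurjModEight : Prop := W.HasSurjectiveModNGaloisRep 8

/-- Image axis, small: `E` has a rational point of order `2` (⟺ `E[2]` reducible ⟺ image of `ρ̄_{E,2}`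
in `GL₂(𝔽₂) ≅ S₃` of order `≤ 2`). `= Red W 2`. The remaining small case "image `C₃`" is
`Irr W 2 ∧ ¬ Surj W 2`. [folklore] -/
def RationalTwoTorsion : Prop := Red W 2

omit [W.IsElliptic] [W.IsGloballyMinimal] in
/-- The image axis at `2` is exhaustive at the residual level: `S₃` (surjective mod `2`), `C₃`
(irreducible, not surjective), or reducible. [folklore] -/
theorem image_exhaustive : Surj W 2 ∨ (Irr W 2 ∧ ¬ Surj W 2) ∨ RationalTwoTorsion W := by
  unfold RationalTwoTorsion Red
  by_cases hi : Irr W 2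
  · by_cases hs : Surj W 2
    · exact Or.inl hs
    · exact Or.inr (Or.inl ⟨hi, hs⟩)
  · exact Or.inr (Or.inr hi)

/-! ## §2 (E1) The `2`-adic leading-term conjecture, typed, with the census control-term slot -/

/-- **E1 target (analytic side) — the `2`-adic Birch–Swinnerton-Dyer conjecture at a good ordinary
`2`**: Mazur–Tate–Teitelbaum's BSD(`p`) at `p = 2` for the `2`-adic height datum `D`, i.e. the tree's
`PAdicBSDConjecture W 2 D` (order of vanishing `= rank`, leading coefficient
`ϖ·[T^r]L₂·log₂(γ)^r·#tors² = (1 - α⁻¹)²·#Ш·Reg₂(D)·∏c_v`; at `2`, `γ_cyc = 1 + 4 = 5`, `α` the unit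
root of `X² - a₂X + 2`, `ord₂(1 - α⁻¹)² = 2·ord₂ #Ẽ(𝔽₂) ∈ {2, 4}`). CENSUS (CLASS-CLOSURE-PLAN §3.9,
experiment X8, worker cp-bsd-w4, ≈ 43 core-h, PRE-REGISTERED per §1 2a–2h, NOT RUN at filing
2026-08-21): STEP-0 = the interpolation identity `L₂(E,0) = (1-α⁻¹)²·L(E,1)/Ω⁺` reproduced
`2`-adically on closed-at-2 classes; discovery = the rank-one `2`-adic regulator normalisation and
any correction; dictionary atoms `(1 - α⁻¹)²`, `2^a`, `c_∞`, `#E(ℚ)[2]`, `#E(ℝ)[2]`, `ord₂ ∏c_ℓ`,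
split/nonsplit at `2`; held-out = hash third + the 62 (`N < 2·10⁴`) / 627 (`N < 10⁵`) members of the
5 295. EVIDENCE label; report path and sha to be appended here by the census typer when it exists.
OPEN (in print as a conjecture); nothing asserted. [cite: MazurTateTeitelbaum1986Invent, §II.10 Conj. BSD(p)] -/
@[conjecture] def TwoAdicBSD (D : PAdicHeightData W 2) : Prop := PAdicBSDConjecture W 2 D

omit [W.IsElliptic] [W.IsGloballyMinimal] in
/-- Unfolding. [cite: MazurTateTeitelbaum1986Invent, §II.10] -/
theorem twoAdicBSD_iff (D : PAdicHeightData W 2) : TwoAdicBSD W D ↔ PAdicBSDConjecture W 2 D :=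
  Iff.rfl

/-- **E1 target (algebraic side) — Greenberg's rank-`0` Euler-characteristic formula AT `2` with the
census CONTROL-TERM slot `δ`.** For `W/ℚ` globally minimal, good ordinary at `2`, the cyclotomic
`ℤ₂`-extension with a matching topological generator, a dual datum `D` with `X` finitely generated
torsion and `char X = (f_E)`, and `Sel_{2^∞}(E/ℚ)` finite:
`f_E(0)·#E(ℚ)(2)² = u · 2^{ord₂ ∏_ℓ c_ℓ + δ} · #Ẽ(𝔽₂)(2)² · #Sel_{2^∞}(E/ℚ)` for some `u ∈ ℤ₂ˣ`.
`δ = 0` is EXACTLY the printed statement of Greenberg 1999 Thm. 4.1 read at `p = 2` (no parity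
hypothesis on p. 102; the text carries `p = 2` through Lemma 4.6 via the archimedean factor, held
copy chunks p0105–p0106) = the tree fact `greenberg_charValue_rankZero` with its binder `p ≠ 2`
removed — a CITE-AUDIT item for the referee (is the printed proof complete at `2`?), not a new
theorem. The census (X8) fits `δ` as a function of the dictionary atoms on closed-at-2 classes;
prediction of record: `δ = 0` on O1-go. EVIDENCE label; nothing asserted.
[cite: GreenbergLNM1716, Thm. 4.1 (p. 102) and the p = 2 archimedean remark before Lemma 4.6 (held copy chunks p0105–p0106)] -/
@[conjecture] def TwoAdicEulerCharRankZero (δ : ℤ) : Prop :=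
  IsOrdinaryAt W 2 →
  ∀ (κ : ZpExtension ℚ 2) (γ : Field.absoluteGaloisGroup ℚ),
    κ.IsCyclotomic → κ.IsTopGenerator γ → IsCyclotomicVariable 2 γ →
  ∀ (D : W.SelmerDualData κ γ) [Module.Finite (IwasawaAlgebra 2) D.X], D.IsTorsion →
  ∀ (fE : IwasawaAlgebra 2), D.charIdeal = Ideal.span {fE} →
    Finite (W.selmerGroupPInfty 2) →
    ∃ u : ℤ_[2]ˣ,
      ((PowerSeries.constantCoeff fE : ℤ_[2]) : ℚ_[2]) *
          (Nat.card (AddCommGroup.primaryComponent W.toAffine.Point 2) : ℚ_[2]) ^ 2 =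
        ((u : ℤ_[2]) : ℚ_[2]) * (2 : ℚ_[2]) ^ ((padicValNat 2 W.tamagawaProduct : ℤ) + δ) *
          (Nat.card (AddCommGroup.primaryComponent
            ((integralModelInt W).map (Int.castRingHom (ZMod 2))).toAffine.Point 2) : ℚ_[2]) ^ 2 *
          (Nat.card (W.selmerGroupPInfty 2) : ℚ_[2])

/-! ## §3 (E2) Prover targets: the near-verbatim extension and the irreducible residue -/

/-- **E2 VERBATIM-EXTENSION TARGET (→ provers) — Kato's divisibility at `2`, integral up to `2^k`.**
For `E/ℚ` (globally minimal `W`) good ordinary at `2` with `ρ_{E,2^∞}` SURJECTIVE, the cyclotomic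
`ℤ₂`-extension, the newform `f` and every dual datum `D`: `X` is `Λ`-torsion and
`2ⁿ·L₂(E,T) = ι g` for some `g ∈ char_Λ X` and some `n ≤ k`. `k = 0` is Kato Thm. 17.4 (3) READ AT
`p = 2` — NOT IN PRINT (17.4 (3), 12.5 (4), 13.4 (3) all print `p ≠ 2`; 17.13: "(17.13.1) … exact upto
`×2` in the case `p = 2`"; 12.1.2: a cokernel killed by `2`); `k` UNBOUNDED is in print (17.4 (1)(2),
`katoDivisibilityAtTwoUpTo_of_allPrimes`). The prover's task is the bookkeeping of the powers of `2`
lost in Kato §§12–17 on the locus `TwoAdicSurjective W` (rank 0: then Greenberg at `2` turns it into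
`MissingUpperBoundAt W 2` up to `k`). A TARGET; nothing asserted.
[cite: Kato2004Asterisque, Thm. 17.4 (p. 273) and 17.13 (pp. 279–280) (shape only; p = 2 integral clause NOT in print)] -/
def KatoDivisibilityAtTwoUpTo (k : ℕ) {N : ℕ} [NeZero N] (f : CuspForm (Gamma0 N) 2) : Prop :=
  ∀ (κ : ZpExtension ℚ 2) (γ : Field.absoluteGaloisGroup ℚ), κ.IsCyclotomic →
    κ.IsTopGenerator γ → IsCyclotomicVariable 2 γ → IsOrdinaryAt W 2 → IsNewformOf W f →
    TwoAdicSurjective W →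
    ∀ D : W.SelmerDualData κ γ, D.IsTorsion ∧
      ∃ (n : ℕ) (g : IwasawaAlgebra 2), n ≤ k ∧ g ∈ D.charIdeal ∧
        iwasawaToPowerSeries 2 g =
          PowerSeries.C ((2 : ℚ_[2]) ^ n) * padicLFunction f (unitRoot W 2 : ℚ_[2])

omit [W.IsElliptic] in
/-- What IS in print at `2`: Kato 17.4 (1)(2) (`kato_divisibility_allPrimes W 2`, no parity
hypothesis) gives the target for SOME `k` (depending on the datum) — with no bound, hence no
`BSD(E,2)` consequence. [cite: Kato2004Asterisque, Thm. 17.4 (1)(2) (p. 273)] -/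
theorem katoDivisibilityAtTwoUpTo_of_allPrimes {N : ℕ} [NeZero N] (f : CuspForm (Gamma0 N) 2)
    (h : kato_divisibility_allPrimes W 2 (f := f))
    (κ : ZpExtension ℚ 2) (γ : Field.absoluteGaloisGroup ℚ) (hκ : κ.IsCyclotomic)
    (hγ : κ.IsTopGenerator γ) (hγ' : IsCyclotomicVariable 2 γ) (hord : IsOrdinaryAt W 2)
    (hf : IsNewformOf W f) (D : W.SelmerDualData κ γ) :
    ∃ k : ℕ, D.IsTorsion ∧ ∃ (n : ℕ) (g : IwasawaAlgebra 2), n ≤ k ∧ g ∈ D.charIdeal ∧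
        iwasawaToPowerSeries 2 g =
          PowerSeries.C ((2 : ℚ_[2]) ^ n) * padicLFunction f (unitRoot W 2 : ℚ_[2]) := by
  obtain ⟨htor, n, g, hg, hι⟩ := h κ γ hκ hγ hγ' hord hf D
  exact ⟨n, htor, n, g, le_rfl, hg, hι⟩

/-- **E2 IRREDUCIBLE RESIDUE (→ ideation) — the Eisenstein ("Skinner–Urban") half of the cyclotomic
main conjecture AT `2`, Néron normalisation**: for the cyclotomic `ℤ₂`-extension, the newform `f` at
level `N_E`, the rational `ϖ` with `ϖ·Ω_E = Ω⁺_f` and every dual datum `D`: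
`ϖ·L₂(f, α) = ι g` for some `g ∈ char_Λ X(E/ℚ_∞)`, i.e. `char_Λ X ∣ 𝓛₂^{MSD}(E)` in `Λ`. Exactly the
lower half of the cell's `MazurMainConjecture W 2` (`mainConjectureLowerDivisibilityAtTwo_of_mazurMainConjecture`).
NOTHING in print or announced at `p = 2` for a non-CM curve: Skinner–Urban 2014 p. 13 "Throughout
this paper `p` is a fixed odd prime", and every later ordinary IMC (Wan, CGS, BCS, Keller–Yin) keeps
`p` odd. OPEN; nothing asserted. [cite: SkinnerUrban2014, Thm. 3.6.9 / §3.6 (p odd; shape only; nothing asserted)] -/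
@[conjecture] def MainConjectureLowerDivisibilityAtTwo : Prop :=
  ∀ (κ : ZpExtension ℚ 2) (γ : Field.absoluteGaloisGroup ℚ),
      κ.IsCyclotomic → κ.IsTopGenerator γ → IsCyclotomicVariable 2 γ →
    ∀ [NeZero (W.conductorNorm ℤ)] (f : CuspForm (Gamma0 (W.conductorNorm ℤ)) 2),
      IsNewformOf W f → ∀ (ϖ : ℚ), (ϖ : ℝ) * W.realPeriodRat = plusPeriod f →
    ∀ (D : W.SelmerDualData κ γ), ∃ g ∈ D.charIdeal,
        iwasawaToPowerSeries 2 g =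
          PowerSeries.C (ϖ : ℚ_[2]) * padicLFunction f (unitRoot W 2 : ℚ_[2])

/-- The typed residue is the Eisenstein HALF of the cell's main-conjecture obligation at `2`
(`MazurMainConjecture W 2`: `char X = (g)` with `ι g = ϖ·L₂`). Bookkeeping. [cite: CastellaGrossiSkinner2025, Introduction (MC) (shape)] -/
theorem mainConjectureLowerDivisibilityAtTwo_of_mazurMainConjecture
    (h : MazurMainConjecture W 2) : MainConjectureLowerDivisibilityAtTwo W := by
  intro κ γ hκ hγ hγ' _ f hf ϖ hϖ D
  obtain ⟨-, g, hchar, hι⟩ := h κ γ hκ hγ hγ' f hf ϖ hϖ D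
  exact ⟨g, hchar ▸ Ideal.mem_span_singleton_self g, hι⟩

/-! ## §4 (E3) Transport comparison statements at `2` -/

omit [W.IsGloballyMinimal] in
/-- **E3-ISO (in the KERNEL already): `BSD(E,2)` is a `ℚ`-isogeny-class statement at analytic rank
`≤ 1`** — Cassels 1965 (`bsdRHS_eq_of_isIsogenous`) + GZK finiteness + modularity, through
`Typed.X5.bsdp_two_of_isIsogenous` in both directions. Consequence for O1: the defect
`ord₂ #Ш - ord₂ #Ш_an` is a class invariant, so ONE certificate per isogeny class suffices and no
class is decidable by a cheaper descent on an isogenous curve unless `min v₂(#Ш_an) ≤ 2` there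
(rmap-3 g5: never, on the 5 295). [cite: Cassels1965ArithmeticVIII, Thm. 1.3 via Milne ADT I.7.3] -/
theorem bsdp_two_iff_of_isIsogenous [W.IsGloballyMinimal]
    (hGZK : rank_eq_analyticRank_of_analyticRank_le_one) (hCassels : bsdRHS_eq_of_isIsogenous)
    (hmod : hasEntireLFunction_rat) {W' : WeierstrassCurve ℚ} [W'.IsElliptic] [W'.IsGloballyMinimal]
    (hiso : IsIsogenous W W') (hr : W.analyticRank ≤ 1) : BSDp W 2 ↔ BSDp W' 2 := by
  have hr' : W'.analyticRank ≤ 1 := by rwa [← analyticRank_eq_of_isIsogenous' hiso]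
  exact ⟨fun h => (X5.bsdp_two_of_isIsogenous W' hGZK hCassels hmod hiso.symm_of_charZero hr h).2,
    fun h => (X5.bsdp_two_of_isIsogenous W hGZK hCassels hmod hiso hr' h).2⟩

/-- **E3-TW TARGET — quadratic-twist transport of the `2`-part, as a comparison statement.** For a
globally minimal model `Wd` of the quadratic twist `E^{(d)}` (`C • W^{(d)} = Wd`), both of analytic
rank `≤ 1`: the `2`-part in Miller's currency transports, `MissingPPartAt W 2 ↔ MissingPPartAt Wd 2`.
PRINTED INSTANCES (all with hypotheses forcing `Ш[2]`-triviality on both sides, hence disjoint from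
the 5 295 residue classes, where `2⁴ ∣ #Ш_an` on every curve): Cai–Li–Zhai 2020 Thm. 1.5 (optimal
`E`, odd Manin constant, `E(ℚ)[2] ≅ ℤ/2`, `ord₂ L^{alg}(E,1) = -1`, `M = q₁⋯q_r`, `qᵢ ∈ 𝒮`,
`Ш(E')[2] = 0`, every `ℓ ∣ 2C` split in `ℚ(√M)`: BSD(E,2) ⟹ `Ш(E^{(M)})[2^∞] = 0` ∧ BSD(E^{(M)},2));
Shu–Zhai 2021 Thm. 1.4 (`f([0]) ∉ 2E(ℚ)`, (Tor), `p ≡ 3 (4)` Heegner, admissible `qᵢ`, odd Manin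
constant, every `ℓ ∣ 2N` split in `ℚ(√-p)` and `ℚ(√M)`: BSD(E,2) ⟹ BSD(E^{(M)},2) ∧ BSD(E^{(-pM)},2),
ranks `0` and `1`; the twists' `Ш` have ODD order); Kriz–Li 2019 Thm. 5.1 (2) (`E(ℚ)[2] = 0`,
Heegner `K` with `2` split and (★), `c₂` odd, odd Manin constant if additive at `2`:
BSD(E,2) ∧ BSD(E^{(d_K)},2) ⟹ BSD(E^{(d)},2) ∧ BSD(E^{(d·d_K)},2) for `d ∈ 𝒩`, `ψ_d(-N) = 1`;
`Sel₂` of rank `≤ 1` throughout). The GENERAL statement is NOT in print; the census (E3, cc-eng-3) tabulates, per O1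
pair, the twist-minimal partner and whether it is closed at `2`. A TARGET; nothing asserted.
[cite: CaiLiZhai2019, Thm. 1.5] [cite: ShuZhai2021, Thm. 1.4] [cite: KrizLi2019, Thm. 5.1 (2)] -/
def TwistTransportAtTwo (d : ℚ) (Wd : WeierstrassCurve ℚ) [Wd.IsElliptic] [Wd.IsGloballyMinimal] :
    Prop :=
  (∃ C : VariableChange ℚ, C • W.quadraticTwist d = Wd) →
    W.analyticRank ≤ 1 → Wd.analyticRank ≤ 1 → (MissingPPartAt W 2 ↔ MissingPPartAt Wd 2)

/-- **E3-CONG TARGET — congruence (level-lowering / level-raising mod `2ᵐ`) transport of the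
`2`-part, as a comparison statement.** For two globally minimal elliptic `W, W'` of analytic rank `≤ 1`
whose `2ᵐ`-torsion Galois modules are isomorphic (`E[2ᵐ] ≅ E'[2ᵐ]` `Γ_ℚ`-equivariantly, recorded as a
hypothesis `hcong` the prover will instantiate — e.g. every quadratic twist at `m = 1`):
`MissingPPartAt W 2 ↔ MissingPPartAt W' 2`. PRINTED ANTECEDENT (a mod-`2` instance along Heegner
points, not this statement): Kriz–Li 2019 Thm. 1.16 (congruence of `p`-adic logarithms of Heegner
points under `E[pᵐ]^{ss} ≅ E'[pᵐ]^{ss}`) and Thm. 5.1 (1) (BSD(2) for `E/K` ⟹ for `E^{(d)}/K`,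
`d ∈ 𝒩`). As stated here (bare congruence ⟹ equal `2`-defect) the statement is certainly too strong —
the prover's job is to find the local conditions (Mazur–Rubin "silent primes", Tamagawa parities,
`c_∞`) under which it holds; the census (E3) supplies candidate pairs. A TARGET SCHEMA; nothing
asserted. [cite: KrizLi2019, Thm. 1.16 and Thm. 5.1 (1) (antecedent; shape only)] -/
def CongruenceTransportAtTwo (W' : WeierstrassCurve ℚ) [W'.IsElliptic] [W'.IsGloballyMinimal]
    (hcong : Prop) : Prop :=
  hcong → W.analyticRank ≤ 1 → W'.analyticRank ≤ 1 → (MissingPPartAt W 2 ↔ MissingPPartAt W' 2)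

omit [W.IsGloballyMinimal] in
/-- Sanity/bookkeeping: on an ISOGENOUS pair the congruence-transport schema holds with any
hypothesis, by E3-ISO (both `MissingPPartAt` sides are equivalent to `BSD(·,2)` under GZK).
[cite: Cassels1965ArithmeticVIII, via bsdRHS_eq_of_isIsogenous] -/
theorem congruenceTransportAtTwo_of_isIsogenous [W.IsGloballyMinimal]
    (hGZK : rank_eq_analyticRank_of_analyticRank_le_one) (hCassels : bsdRHS_eq_of_isIsogenous)
    (hmod : hasEntireLFunction_rat) {W' : WeierstrassCurve ℚ} [W'.IsElliptic] [W'.IsGloballyMinimal]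
    (hiso : IsIsogenous W W') (hcong : Prop) : CongruenceTransportAtTwo W W' hcong := by
  intro _ hr hr'
  haveI : Finite W.sha := (hGZK W hr).2
  haveI : Finite W'.sha := (hGZK W' hr').2
  constructor
  · intro h
    exact missingPPartAt_of_bsdp W' 2
      ((bsdp_two_iff_of_isIsogenous W hGZK hCassels hmod hiso hr).1
        (bsdp_of_missingPPartAt W 2 hGZK hr h))
  · intro h
    exact missingPPartAt_of_bsdp W 2
      ((bsdp_two_iff_of_isIsogenous W hGZK hCassels hmod hiso hr).2
        (bsdp_of_missingPPartAt W' 2 hGZK hr' h))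

end Summit.BirchSwinnertonDyer.Rank1Residual.X5.O1

end
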